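import Mathlib
import Summits.Langlands.Langlands.Theses.PhantomRMYoshida
import Summits.Langlands.Langlands.Theorems.PhantomRMYoshidaStableYoshidaCongruenceSector
import Summits.Langlands.Langlands.Theorems.PhantomRMYoshidaStableYoshidaCongruenceBWSector
import Summits.Langlands.Langlands.Theorems.PhantomRMYoshidaStableYoshidaCongruenceModFaltingsResidue
import Summits.Langlands.Langlands.Theorems.PhantomRMYoshidaFaltingsTateModuleQGate
import Literature.NumberTheory.GaloisRepresentations.SerreWeight
import Literature.NumberTheory.GaloisRepresentations.ResidualPair
import Literature.NumberTheory.DiophantineGeometry.AbelianVarietyOrdinaryReduction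
import Literature.AlgebraicGeometry.Motives.FaltingsAbelian
import Literature.AlgebraicGeometry.Motives.FaltingsFinitenessI
import HarnessLib

/-!
# Route `PhantomRMYoshida`, crux `StableYoshidaCongruence` (stmt-Langlands-13640), line
# `semistable-three-adic-anchor`: Greenberg `(0,0,1,1)` from the ordinary FILTRATION (stub `stub_greenbergOfOrdinaryFiltration`)

Two registered reshape stubs of the line `semistable-three-adic-anchor` (planner crux-plan round 2, checked skeleton
`Cruxes/StableYoshidaCongruence/Lines/semistable_three_adic_anchor.lean`; lead a2 reshape), both proved here from landed
material only:

* `stub_greenbergOfOrdinaryFiltration` — for an abelian surface `B/ℚ`, a `ℚ_p`-basis `b` of `V_p B` and its framed `H¹`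
  `ρ₀` (`TateFrame`), if `V_p(B)` is ORDINARY-FILTERED at `v ∣ p` (`IsOrdinaryFilteredAt`, copied verbatim from the
  skeleton: a `Γ_{ℚ_v}`-stable plane `W` with inertia `= χ_p` on `W` and trivial on `V/W` — verbatim the conclusion of the
  Serre–Tate fact `ordinaryReduction_tateModule_filtration` at `K = ℚ`, but also the output format of SEMISTABLE ordinary
  reduction) then `ρ₀` is Greenberg-ordinary of shape `(0,0,1,1)` at `v`.  The proof is the landed proof of
  `…LevelThreeWeierstrassSwitch.stub_tateModuleGreenberg` (Theorems/…TateModuleGreenberg.lean) from its second line on —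
  dualise the filtration in an adapted basis, triangularise the two commuting `2 × 2` block families over `ℚ̄_p` — with the
  filtration taken as a HYPOTHESIS instead of being obtained from Serre–Tate + good reduction.  This decouples the
  Greenberg dictionary from good reduction (the semistable line's point) and is reusable by every motivic sector.
* `stub_semistableSectorModuloLever` — the `p = 3` SEMISTABLE SECTOR THEOREM: granted the four published facts of the
  Burkhardt–Weddle sector theorem (`FaltingsFinitenessI` = route gate item stmt-Langlands-15084, Serre–Tate, the printed
  BCGP `2`–`3` switch `bcgp_switch_exists_modular_abelianSurface`, the Weil pairing — same interface and order as the landed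
  `stub_bwSectorModuloFacts`, p117182) and granted THE LEVER of the line (the statement `TresRamifieSwitch` of its registered
  stub `stub_tresRamifieSwitch`, inlined verbatim as the fifth hypothesis: the semistable sibling of BCGP Lemma 9.4.2 for
  Yoshida-type `ρ̄` with a TRÈS RAMIFIÉ block at `3`, output keyed to the ordinary filtration — NOT in print, hence not a
  Literature fact), the crux holds at every datum of the SEMISTABLE SECTOR (inlined: `p = 3`, `charpoly σ · charpoly σ'`
  `𝔽₃`-rational, unramified at `2` with `P₁ P₂ ≠ (X² ± X + 2)²`; NOTHING assumed at `3`).  Proof = the skeleton's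
  sorry-free chain: `semistableSwitchable_of_sector` (landed BW stubs `stub_modelFp`, `stub_symplecticFormFp`,
  `stub_localConditionsTransfer`, `stub_residualLattice`, `stub_ordinaryFrameFp`: the ordinary SHAPE at `3` is derived from
  the crux's H5-witness), the case split peu/très ramifié (`bcgp_switch_exists_modular_abelianSurface` + Serre–Tate, resp. the
  lever), then the framed `H¹` dictionary (`framedH1`, `isSymplectic_framedH1`, `hasResidualPair_of_congruence`,
  `stub_tateModuleIrreducible_of` via `faltings_tate_bijective_of_finitenessI` /
  `isSemisimpleRepresentation_rationalTateRep_of_finitenessI`, `stub_greenbergOfOrdinaryFiltration`,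
  `stub_charpolyCongruence` + `stub_distinguishedTransferLocal`, automorphy from the switch).

`IsOrdinaryShapedAt` and `IsOrdinaryFilteredAt` are copied VERBATIM from the checked skeleton so that the registered
signatures elaborate identically; everything else is imported (LTWS: `IsModelOf`, `IsSwitchableAtTwo`, `TateFrame`,
`EndTrivial`, `epsBar`, `DetCond`, `CruxAt`, `AutGL4`, `Sh`; BW: the transfer stubs).  Lead prover-line-stmt-Langlands-13640-a2-0,
2026-08-16.
-/

set_option linter.dupNamespace false

noncomputable section

open CategoryTheory IsDedekindDomain Polynomial
open scoped NumberField commutatorElement Matrix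
open Literature.NumberTheory.GaloisRepresentations Literature.NumberTheory.Automorphic
open Literature.AlgebraicGeometry.Motives (AbelianVariety)
open Literature.NumberTheory.DiophantineGeometry (weilPairing_rationalTateModule
  ordinaryReduction_tateModule_filtration bcgp_switch_exists_modular_abelianSurface)
open Summit.Langlands.Langlands.Theses.PhantomRMYoshida
open Summit.Langlands.Langlands.Theorems.PhantomRMYoshida (faltings_tate_bijective_of_finitenessI
  isSemisimpleRepresentation_rationalTateRep_of_finitenessI)
open Summit.Langlands.Langlands.Cruxes.StableYoshidaCongruence.LevelThreeWeierstrassSwitch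
open Summit.Langlands.Langlands.Cruxes.StableYoshidaCongruence.BurkhardtWeddleTwoThreeAnchor

namespace Summit.Langlands.Langlands.Cruxes.StableYoshidaCongruence.SemistableThreeAdicAnchor

/-! ## Vocabulary (verbatim from the checked skeleton) -/

section Vocabulary

variable (p : ℕ) [Fact p.Prime]

/-- **`IsOrdinaryFilteredAt p B v`** (`v ∣ p`): the `p`-adic Tate module `V_p(B)` of the abelian variety `B/ℚ` is
ORDINARY-FILTERED at `v` — there is a `Γ_{ℚ_v}`-stable `ℚ_p`-subspace `W ⊂ V_p(B)` of dimension `dim B` on which inertia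
acts through the `p`-adic cyclotomic character and such that inertia acts trivially on `V_p(B)/W`.  VERBATIM the
conclusion of the Literature fact `ordinaryReduction_tateModule_filtration` (Serre–Tate, for GOOD ordinary reduction) at
`K = ℚ` (granted that fact as `hST`, good ordinary reduction at `v` gives it: `hST B v p hv hord`).  It is the OUTPUT FORMAT of
the semistable switch because it also holds for `B/ℚ_p` SEMISTABLE with ORDINARY Raynaud abelian part
(arXiv:2502.20645, Definition "semistable ordinary reduction" closing §9.1, p.127 of the held text) — a notion the tree cannot yet name (no tori / multiplicative
reduction for abelian varieties; header of `AbelianVarietyOrdinaryReduction.lean`).  Proof of that claim (paper,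
elementary): let `0 → T → G → A' → 0` be the Raynaud extension over `ℤ_p` and `B^rig = G^rig/Λ` (Raynaud; SGA7 IX;
Faltings–Chai II–III); put `W := V_p(Ĝ)`, `Ĝ` the formal group of `G` — an extension of `Â'` by `T̂`, `p`-divisible of
dimension `2` and, `A'` being ordinary, of height `dim T + dim A' = 2`, hence of MULTIPLICATIVE type, so `W` is a
`Γ_{ℚ_p}`-stable plane on which inertia acts by the scalar `χ_p`; and inertia acts TRIVIALLY on `B[pⁿ]/Ĝ[pⁿ]`: for
`y ∈ G(K̄)` with `pⁿy = λ ∈ Λ`, write `y = t·u` with `t ∈ T(K̄)`, `u ∈ G(𝒪_K̄)` (`G(K̄) = T(K̄)·G(𝒪_K̄)` as `A'` is proper);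
for `τ` in inertia `τy − y = (τt − t) + (τu − u)` with `τt − t ∈ T[pⁿ] ⊂ Ĝ[pⁿ]` and `τu − u ∈ G[pⁿ]` reducing to `0`
(inertia acts trivially on the special fibre), i.e. `τu − u ∈ Ĝ[pⁿ]`.
[cite: Raynaud1994UnMotifs, §3–§4 (rigid uniformisation G^rig/Λ, the p-adic Tate module of a semistable abelian variety)]
[cite: GrothendieckSGA7IX, §2, §7 (Raynaud extension; toric and finite parts)] [cite: Greenberg1991, §2] -/
def IsOrdinaryFilteredAt (B : AbelianVariety ℚ) (v : HeightOneSpectrum (𝓞 ℚ)) : Prop :=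
  ∃ W : Submodule ℚ_[p] (B.rationalTateModule p),
    Module.finrank ℚ_[p] W = B.dim ∧
    (∀ (τ : Field.absoluteGaloisGroup (v.adicCompletion ℚ)), ∀ w ∈ W,
        B.rationalTateRep p (absGaloisRestrict ℚ (v.adicCompletion ℚ) τ) w ∈ W) ∧
    (∀ τ ∈ absInertia (v.adicCompletion ℚ), ∀ w ∈ W,
        B.rationalTateRep p (absGaloisRestrict ℚ (v.adicCompletion ℚ) τ) w =
          (((GaloisRep.cyclotomicCharacter (v.adicCompletion ℚ) p τ : ℤ_[p]ˣ) : ℤ_[p]) : ℚ_[p]) • w) ∧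
    (∀ τ ∈ absInertia (v.adicCompletion ℚ), ∀ x : B.rationalTateModule p,
        B.rationalTateRep p (absGaloisRestrict ℚ (v.adicCompletion ℚ) τ) x - x ∈ W)

end Vocabulary

/-! ## Greenberg `(0,0,1,1)` from the ordinary filtration (registered stub `stub_greenbergOfOrdinaryFiltration`) -/

/-- **Greenberg `(0,0,1,1)` from the ordinary FILTRATION** (registered reshape stub of the line
`semistable-three-adic-anchor`; the skeleton's `GreenbergOfOrdinaryFiltration` / `greenberg_of_ordinaryFiltration`,
statement unfolded).  For an abelian surface `B/ℚ`, a `ℚ_p`-basis `b` of `V_p B` and its framed `H¹` `ρ₀`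
(`TateFrame p B b ρ₀`: `ρ₀(g) = [g⁻¹]_bᵀ ⊗ ℚ̄_p`), if `V_p(B)` is ordinary-filtered at `v ∣ p` then `ρ₀` is
Greenberg-ordinary of shape `(0,0,1,1)` at `v` (tree `IsGreenbergOrdinaryOfShapeAt`: unramified rank-2 sub `W^⊥`,
quotient `W^∨ = χ⁻¹ ⊗ unr`, the two blocks triangularised over `ℚ̄_p` as commuting families, inertia scalar inside each
block).  VERBATIM the landed proof of `…LevelThreeWeierstrassSwitch.stub_tateModuleGreenberg` from its second line on,
the Serre–Tate step replaced by the hypothesis. [cite: Greenberg1991, §2] [cite: BoxerEtAl2021, §7.3 (p-distinguished weight-2 ordinary)] -/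
theorem stub_greenbergOfOrdinaryFiltration :
    ∀ (p : ℕ) [Fact p.Prime] (B : AbelianVariety ℚ)
      (b : Module.Basis (Fin 4) ℚ_[p] (B.rationalTateModule p)) (ρ₀ : FramedGaloisRep ℚ (PadicAlgCl p) 4),
      TateFrame p B b ρ₀ → B.dim = 2 →
      ∀ v : HeightOneSpectrum (𝓞 ℚ), ((p : ℕ) : 𝓞 ℚ) ∈ v.asIdeal → IsOrdinaryFilteredAt p B v →
        ρ₀.IsGreenbergOrdinaryOfShapeAt v ![0, 0, 1, 1] := by
  intro p _ B b ρ₀ hfr hdim v hv hfilt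
  obtain ⟨W, hWdim, hWstab, hWI, hWquot⟩ := hfilt
  set ρ := B.rationalTateRep p with hρ
  set r := absGaloisRestrict ℚ (v.adicCompletion ℚ) with hr
  set χ := GaloisRep.cyclotomicCharacter (v.adicCompletion ℚ) p with hχ
  haveI : FiniteDimensional ℚ_[p] (B.rationalTateModule p) := Module.Finite.of_basis b
  have hV4 : Module.finrank ℚ_[p] (B.rationalTateModule p) = 4 := by
    simpa using Module.finrank_eq_card_basis b
  rw [hdim] at hWdim
  obtain ⟨b', hb'W, hb'repr⟩ := exists_basis_adapted hV4 W hWdim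
  -- the matrices of `Γ_ℚ` in the adapted basis
  set A' : Field.absoluteGaloisGroup ℚ → Matrix (Fin 4) (Fin 4) ℚ_[p] :=
    fun σ => LinearMap.toMatrix b' b' (ρ σ) with hA'
  have hA'mul : ∀ σ σ', A' (σ * σ') = A' σ * A' σ' := fun σ σ' => by
    simp only [A', map_mul, LinearMap.toMatrix_mul]
  have hF1 : ∀ (τ' : Field.absoluteGaloisGroup (v.adicCompletion ℚ)) (i j : Fin 2),
      A' (r τ') (Fin.castAdd 2 j) (Fin.natAdd 2 i) = 0 := fun τ' i j => by
    simp only [A', LinearMap.toMatrix_apply]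
    exact hb'repr _ (hWstab τ' _ (hb'W i)) j
  have hF2 : ∀ τ' ∈ absInertia (v.adicCompletion ℚ), ∀ (i : Fin 2) (k : Fin 4),
      A' (r τ') k (Fin.natAdd 2 i) =
        if Fin.natAdd 2 i = k then (((χ τ' : ℤ_[p]ˣ) : ℤ_[p]) : ℚ_[p]) else 0 := by
    intro τ' hτ' i k
    simp only [A', LinearMap.toMatrix_apply]
    rw [hWI τ' hτ' _ (hb'W i), map_smul, Module.Basis.repr_self, Finsupp.smul_apply,
      Finsupp.single_apply, smul_eq_mul, mul_ite, mul_one, mul_zero]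
  have hF3 : ∀ τ' ∈ absInertia (v.adicCompletion ℚ), ∀ (k : Fin 4) (j : Fin 2),
      A' (r τ') (Fin.castAdd 2 j) k = if k = Fin.castAdd 2 j then 1 else 0 := by
    intro τ' hτ' k j
    simp only [A', LinearMap.toMatrix_apply]
    have h := hb'repr _ (hWquot τ' hτ' (b' k)) j
    rw [map_sub, Finsupp.sub_apply, sub_eq_zero] at h
    rw [h, Module.Basis.repr_self, Finsupp.single_apply]
  -- change of frame from the dual basis of `b` to the dual basis of `b'`
  set fM := (algebraMap ℚ_[p] (PadicAlgCl p)).mapMatrix (m := Fin 4) with hfM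
  set C := b.toMatrix b' with hC
  set C' := b'.toMatrix b with hC'
  have hCC' : C * C' = 1 := b.toMatrix_mul_toMatrix_flip b'
  have hC'C : C' * C = 1 := b'.toMatrix_mul_toMatrix_flip b
  have hA : ∀ σ, LinearMap.toMatrix b b (ρ σ) = C * A' σ * C' := fun σ =>
    (basis_toMatrix_mul_linearMap_toMatrix_mul_basis_toMatrix b b' b b' (ρ σ)).symm
  let g₁ : GL (Fin 4) (PadicAlgCl p) :=
    ⟨(fM C).transpose, (fM C').transpose,
      by rw [← Matrix.transpose_mul, ← map_mul, hC'C, map_one, Matrix.transpose_one],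
      by rw [← Matrix.transpose_mul, ← map_mul, hCC', map_one, Matrix.transpose_one]⟩
  set N' : Field.absoluteGaloisGroup (v.adicCompletion ℚ) → Matrix (Fin 4) (Fin 4) (PadicAlgCl p) :=
    fun τ => (fM (A' (r τ)⁻¹)).transpose with hN'
  have hN0 : ∀ τ, ((g₁ * ρ₀.toLocal v τ * g₁⁻¹ : GL (Fin 4) (PadicAlgCl p)) :
      Matrix (Fin 4) (Fin 4) (PadicAlgCl p)) = N' τ := by
    intro τ
    rw [Units.val_mul, Units.val_mul]
    change (fM C).transpose * ((ρ₀ (r τ) : GL (Fin 4) (PadicAlgCl p)) : Matrix _ _ _) *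
      (fM C').transpose = (fM (A' (r τ)⁻¹)).transpose
    rw [hfr (r τ), hA]
    change (fM C).transpose * (fM (C * A' (r τ)⁻¹ * C')).transpose * (fM C').transpose = _
    rw [← Matrix.transpose_mul, ← Matrix.transpose_mul, ← map_mul, ← map_mul]
    congr 2
    rw [Matrix.mul_assoc, Matrix.mul_assoc, hC'C, Matrix.mul_one, ← Matrix.mul_assoc, hC'C,
      Matrix.one_mul]
  have hN1 : ∀ τ σ, N' (τ * σ) = N' τ * N' σ := fun τ σ => by
    simp only [N', map_mul, mul_inv_rev, hA'mul, Matrix.transpose_mul]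
  have hN'apply : ∀ τ i j, N' τ i j = algebraMap ℚ_[p] (PadicAlgCl p) (A' (r τ⁻¹) j i) := by
    intro τ i j
    rw [map_inv]
    rfl
  have hN2 : ∀ τ (i j : Fin 2), N' τ (Fin.natAdd 2 i) (Fin.castAdd 2 j) = 0 := fun τ i j => by
    rw [hN'apply, hF1, map_zero]
  have hN3 : ∀ τ ∈ absInertia (v.adicCompletion ℚ), ∀ (k : Fin 4) (j : Fin 2),
      N' τ k (Fin.castAdd 2 j) = if k = Fin.castAdd 2 j then 1 else 0 := by
    intro τ hτ k j
    rw [hN'apply, hF3 _ (inv_mem hτ)]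
    split_ifs <;> simp
  set c : Field.absoluteGaloisGroup (v.adicCompletion ℚ) → PadicAlgCl p :=
    fun τ => algebraMap ℚ_[p] (PadicAlgCl p) ((((χ τ)⁻¹ : ℤ_[p]ˣ) : ℤ_[p]) : ℚ_[p]) with hc
  have hN4 : ∀ τ ∈ absInertia (v.adicCompletion ℚ), ∀ (i j : Fin 2),
      N' τ (Fin.natAdd 2 i) (Fin.natAdd 2 j) = if i = j then c τ else 0 := by
    intro τ hτ i j
    rw [hN'apply, hF2 _ (inv_mem hτ), map_inv]
    by_cases hij : i = j
    · subst hij; simp [c]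
    · rw [if_neg (fun h => hij ((Fin.natAdd_inj 2).mp h)), if_neg hij, map_zero]
  -- `2 + 2` block bookkeeping (`e4 : Fin 2 ⊕ Fin 2 ≃ Fin 4`)
  set e4 : Fin 2 ⊕ Fin 2 ≃ Fin 4 := finSumFinEquiv with he4
  have he_inl : ∀ i, e4 (Sum.inl i) = Fin.castAdd 2 i := fun _ => rfl
  have he_inr : ∀ i, e4 (Sum.inr i) = Fin.natAdd 2 i := fun _ => rfl
  have hblk0 : ∀ τ, (N' τ).submatrix e4 e4 = Matrix.fromBlocks ((N' τ).submatrix e4 e4).toBlocks₁₁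
      ((N' τ).submatrix e4 e4).toBlocks₁₂ 0 ((N' τ).submatrix e4 e4).toBlocks₂₂ := fun τ => by
    have h21 : ((N' τ).submatrix e4 e4).toBlocks₂₁ = 0 := by
      ext i j
      simp only [Matrix.toBlocks₂₁, Matrix.of_apply, Matrix.submatrix_apply, he_inr, he_inl, hN2,
        Matrix.zero_apply]
    rw [← h21, Matrix.fromBlocks_toBlocks]
  set TL := fun τ => ((N' τ).submatrix e4 e4).toBlocks₁₁ with hTL
  set TR := fun τ => ((N' τ).submatrix e4 e4).toBlocks₁₂ with hTR
  set BR := fun τ => ((N' τ).submatrix e4 e4).toBlocks₂₂ with hBR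
  have hblk' : ∀ τ, (N' τ).submatrix e4 e4 = Matrix.fromBlocks (TL τ) (TR τ) 0 (BR τ) := hblk0
  have hblk : ∀ τ, N' τ = (Matrix.fromBlocks (TL τ) (TR τ) 0 (BR τ)).submatrix e4.symm e4.symm :=
    fun τ => by rw [← hblk']; simp [Matrix.submatrix_submatrix]
  have hca : ∀ i j : Fin 2, (Fin.castAdd 2 i : Fin 4) = Fin.castAdd 2 j ↔ i = j := fun i j =>
    Fin.castAdd_inj
  have hTL1 : ∀ τ ∈ absInertia (v.adicCompletion ℚ), TL τ = 1 := fun τ hτ => by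
    ext i j
    simp only [TL, Matrix.toBlocks₁₁, Matrix.of_apply, Matrix.submatrix_apply, he_inl, hN3 τ hτ,
      Matrix.one_apply, hca]
  have hBRc : ∀ τ ∈ absInertia (v.adicCompletion ℚ), BR τ = c τ • (1 : Matrix (Fin 2) (Fin 2) _) :=
    fun τ hτ => by
    ext i j
    simp only [BR, Matrix.toBlocks₂₂, Matrix.of_apply, Matrix.submatrix_apply, he_inr, hN4 τ hτ,
      Matrix.smul_apply, Matrix.one_apply, smul_eq_mul, mul_ite, mul_one, mul_zero]
  have hmul : ∀ τ σ, TL (τ * σ) = TL τ * TL σ ∧ BR (τ * σ) = BR τ * BR σ := fun τ σ => by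
    have h : (N' (τ * σ)).submatrix e4 e4 = (N' τ).submatrix e4 e4 * (N' σ).submatrix e4 e4 := by
      rw [hN1, Matrix.submatrix_mul_equiv]
    rw [hblk', hblk', hblk', Matrix.fromBlocks_multiply] at h
    simp only [Matrix.mul_zero, Matrix.zero_mul, add_zero, zero_add] at h
    obtain ⟨h11, -, -, h22⟩ := Matrix.fromBlocks_inj.mp h
    exact ⟨h11, h22⟩
  have hcommI : ∀ τ σ : Field.absoluteGaloisGroup (v.adicCompletion ℚ),
      ⁅τ, σ⁆ ∈ absInertia (v.adicCompletion ℚ) := commutatorElement_mem_absInertia _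
  have hcomm_eq : ∀ τ σ : Field.absoluteGaloisGroup (v.adicCompletion ℚ), τ * σ = ⁅τ, σ⁆ * (σ * τ) :=
    fun τ σ => by group
  have hc1 : ∀ τ σ : Field.absoluteGaloisGroup (v.adicCompletion ℚ), c ⁅τ, σ⁆ = 1 := fun τ σ => by
    have hχ1 : χ ⁅τ, σ⁆ = 1 := by
      rw [map_commutatorElement, commutatorElement_eq_one_iff_mul_comm, mul_comm]
    simp [c, hχ1]
  have hTLcomm : ∀ τ σ, TL τ * TL σ = TL σ * TL τ := fun τ σ => by
    rw [← (hmul τ σ).1, hcomm_eq τ σ, (hmul _ _).1, hTL1 _ (hcommI τ σ), Matrix.one_mul,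
      (hmul σ τ).1]
  have hBRcomm : ∀ τ σ, BR τ * BR σ = BR σ * BR τ := fun τ σ => by
    rw [← (hmul τ σ).2, hcomm_eq τ σ, (hmul _ _).2, hBRc _ (hcommI τ σ), hc1, one_smul,
      Matrix.one_mul, (hmul σ τ).2]
  obtain ⟨X, hX⟩ := exists_conj_upperTriangular_fin_two (Set.range TL)
    (by rintro _ ⟨τ, rfl⟩ _ ⟨σ, rfl⟩; exact hTLcomm τ σ)
  obtain ⟨Y, hY⟩ := exists_conj_upperTriangular_fin_two (Set.range BR)
    (by rintro _ ⟨τ, rfl⟩ _ ⟨σ, rfl⟩; exact hBRcomm τ σ)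
  -- the Greenberg frame `diag(X, Y) · g₁`
  let D : GL (Fin 4) (PadicAlgCl p) :=
    ⟨(Matrix.fromBlocks X.val 0 0 Y.val).submatrix e4.symm e4.symm,
      (Matrix.fromBlocks (X⁻¹).val 0 0 (Y⁻¹).val).submatrix e4.symm e4.symm,
      by simp [Matrix.submatrix_mul_equiv, Matrix.fromBlocks_multiply],
      by simp [Matrix.submatrix_mul_equiv, Matrix.fromBlocks_multiply]⟩
  have hDval : (D : Matrix (Fin 4) (Fin 4) (PadicAlgCl p)) =
      (Matrix.fromBlocks X.val 0 0 Y.val).submatrix e4.symm e4.symm := rfl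
  have hDinv : ((D⁻¹ : GL (Fin 4) (PadicAlgCl p)) : Matrix (Fin 4) (Fin 4) (PadicAlgCl p)) =
      (Matrix.fromBlocks (X⁻¹).val 0 0 (Y⁻¹).val).submatrix e4.symm e4.symm := rfl
  have hZ : ∀ τ, ((D * g₁ * ρ₀.toLocal v τ * (D * g₁)⁻¹ : GL (Fin 4) (PadicAlgCl p)) :
      Matrix (Fin 4) (Fin 4) (PadicAlgCl p)) =
      (Matrix.fromBlocks (X.val * TL τ * (X⁻¹).val) (X.val * TR τ * (Y⁻¹).val) 0
        (Y.val * BR τ * (Y⁻¹).val)).submatrix e4.symm e4.symm := fun τ => by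
    have : D * g₁ * ρ₀.toLocal v τ * (D * g₁)⁻¹ = D * (g₁ * ρ₀.toLocal v τ * g₁⁻¹) * D⁻¹ := by
      group
    rw [this, Units.val_mul, Units.val_mul, hN0 τ, hblk τ, hDval, hDinv]
    simp [Matrix.submatrix_mul_equiv, Matrix.fromBlocks_multiply, Matrix.mul_assoc]
  have he0 : e4.symm 0 = Sum.inl 0 := e4.symm_apply_eq.mpr rfl
  have he1 : e4.symm 1 = Sum.inl 1 := e4.symm_apply_eq.mpr rfl
  have he2 : e4.symm 2 = Sum.inr 0 := e4.symm_apply_eq.mpr rfl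
  have he3 : e4.symm 3 = Sum.inr 1 := e4.symm_apply_eq.mpr rfl
  refine ⟨D * g₁, fun τ i j hij => ?_, fun τ hτ i => ?_, fun τ hτ i j hij ha => ?_⟩
  · have h1 := hX _ ⟨τ, rfl⟩
    have h2 := hY _ ⟨τ, rfl⟩
    simp only [Matrix.coe_units_inv] at h1 h2
    rw [hZ τ]
    fin_cases i <;> fin_cases j <;> simp at hij <;>
      simp [Matrix.submatrix_apply, he0, he1, he2, he3, h1, h2]
  · have hcdef : ∀ τ, c τ =
        algebraMap ℚ_[p] (PadicAlgCl p) ((((χ τ)⁻¹ : ℤ_[p]ˣ) : ℤ_[p]) : ℚ_[p]) := fun _ => rfl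
    rw [hZ τ, hTL1 τ hτ, hBRc τ hτ]
    fin_cases i <;>
      simp [Matrix.submatrix_apply, he0, he1, he2, he3, hcdef, ← hχ, Algebra.algebraMap_eq_smul_one]
  · rw [hZ τ, hTL1 τ hτ, hBRc τ hτ]
    fin_cases i <;> fin_cases j <;> simp at hij ha <;>
      simp [Matrix.submatrix_apply, he0, he1, he2, he3]

end Summit.Langlands.Langlands.Cruxes.StableYoshidaCongruence.SemistableThreeAdicAnchor

end
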